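import Literature.Computability.AlgebraicComplexity.IsotypicOccurrenceKronecker
import Literature.Computability.AlgebraicComplexity.QuantumFunctionalsUpperProofs
import HarnessLib

/-!
# `Δ(⟨4⟩) = Kron(4,4,4)` reduces to hitting the generators of the format-`4` Kronecker semigroup

Topic `Computability/AlgebraicComplexity`; proofs file (theorems only, no definitions, no named
facts) for the named fact `vandenBergEtAl2025_unitTensor_four_polytope_maximal`
(`UnitTensorMomentPolytope.lean`): "every partition triple occurring in a power of a tensor `s` of
format `≤ 4 × 4 × 4` has a multiple occurring in a power of the unit tensor `⟨4⟩`", i.e.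
`Kron(4,4,4) ⊆ Δ(⟨4⟩)` [vandenBergChristandlLysikovNieuwboerWalterZuiddam2025, §1 after Cor. 1.5:
"`Δ(⟨4⟩)` equals `Kron₄₄₄`, as can be seen using the tensor scaling algorithm and knowledge of the
vertices of `Kron₄₄₄`, which were determined in [Vergne–Walter 2017]"]. The source prints no proof;
the fact is a computer verification and stays a cited hypothesis in the tree. This file PROVES the
REDUCTION of the fact to the finitely many generators of the Kronecker semigroup
`K(4,4,4) = {λ : ℓ(λ⁽ʲ⁾) ≤ 4, g(λ) > 0}` (BI 2011 §3.2; finitely generated), which is how such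
statements are established (BI 2011, Lemma 10.18–10.19; vdB et al.: check the Vergne–Walter
vertices):

* `vandenBergEtAl2025_unitTensor_four_polytope_maximal_of_split` — **if every triple `λ ⊢ n` of the
  format-`4` Kronecker semigroup (positive Kronecker coefficient, at most `4` parts in each
  partition) either has a multiple occurring in a power of `⟨4⟩` or is a row-wise sum of two such
  triples of smaller positive degrees, then the named fact holds.** Ingredients (all proved in the
  tree): the hypothesis side of the fact lies in `K(4,4,4)` — positive Kronecker coefficient
  (`kroneckerCoeff_pos_of_isotypicSum₁₂₃_kroneckerPow_ne_zero`, `IsotypicOccurrenceKronecker.lean`)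
  and at most `4` parts (Schur–Weyl vanishing `schurWeyl_isotypicSum_eq_zero_holds`); the conclusion
  side ("some multiple occurs in a power of `⟨4⟩`") is closed under row-wise sums
  (`exists_mul_rowAdd_isotypicSum₁₂₃_kroneckerPow_ne_zero`, `IsotypicOccurrenceSemigroup.lean`);
  strong induction on the degree `n`.

What remains for the named fact itself is therefore exactly the printed (computational) content:
a finite generating set of `K(4,4,4)` (from the Vergne–Walter description of `Kron(4,4,4)`, whose
vertices have denominators up to `24`, [vandenBergEtAl2025ComputingMomentPolytopes, §6.2]) each
member of which has a multiple occurring in a power of `⟨4⟩` (the certified tensor-scaling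
inclusions of [vandenBergEtAl2025ComputingMomentPolytopes, §6.5], or explicit highest-weight
evaluations). Neither is attempted here.

## References

* [vandenBergChristandlLysikovNieuwboerWalterZuiddam2025] M. van den Berg, M. Christandl,
  V. Lysikov, H. Nieuwboer, M. Walter, J. Zuiddam, arXiv:2503.22633, §1 (after Cor. 1.5).
* [vandenBergEtAl2025ComputingMomentPolytopes] same authors, arXiv:2510.08336, §6.2, §6.5.
* [BurgisserIkenmeyer2011] P. Bürgisser, C. Ikenmeyer, arXiv:1011.1350, §3.1–3.2, Lemma 10.18–10.19.
* M. Vergne, M. Walter, *Inequalities for moment cones of finite-dimensional representations*,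
  J. Symplectic Geom. 15 (2017) = arXiv:1410.8144, §6 (extreme rays and facets of `C(4,4,4)`).
-/

noncomputable section

open scoped BigOperators

namespace Literature.Computability.AlgebraicComplexity

open Literature.NumberTheory.DiophantineGeometry (kroneckerCoeff)

/-- The three partitions of an occurring triple have at most as many parts as the corresponding
alphabet has letters (Schur–Weyl vanishing, `schurWeyl_isotypicSum_eq_zero_holds`).
[cite: ChristandlVranaZuiddam2023, §3.1 (sw)] -/
theorem card_parts_le_of_isotypicSum₁₂₃_kroneckerPow_ne_zero {ι κ μ : Type} [Fintype ι] [Fintype κ]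
    [Fintype μ] {n : ℕ} {lam : Fin 3 → Nat.Partition n} {t : ι → κ → μ → ℂ}
    (h : isotypicSum₁ (lam 0) (isotypicSum₂ (lam 1) (isotypicSum₃ (lam 2) (kroneckerPow t n))) ≠ 0) :
    (lam 0).parts.card ≤ Fintype.card ι ∧ (lam 1).parts.card ≤ Fintype.card κ ∧
      (lam 2).parts.card ≤ Fintype.card μ := by
  refine ⟨?_, ?_, ?_⟩ <;> by_contra hlt <;> rw [not_le] at hlt <;> apply h
  · exact (schurWeyl_isotypicSum_eq_zero_holds.{0} (lam 0) _).1 hlt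
  · rw [(schurWeyl_isotypicSum_eq_zero_holds.{0} (lam 1) _).2.1 hlt, isotypicSum₁_zero]
  · rw [(schurWeyl_isotypicSum_eq_zero_holds.{0} (lam 2) _).2.2 hlt, isotypicSum₂_zero, isotypicSum₁_zero]

/-- **Reduction of `Δ(⟨4⟩) = Kron(4,4,4)` to the generators of the Kronecker semigroup.** Suppose
that every partition triple `λ ⊢ n`, `n > 0`, with positive Kronecker coefficient and at most `4`
parts in each partition EITHER has a multiple `kλ` occurring in `⟨4⟩^{⊗kn}` (the conclusion of the
named fact) OR is the row-wise sum (`Nat.Partition.rowAdd`, as multisets of parts) of two such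
triples of smaller positive degrees. Then `vandenBergEtAl2025_unitTensor_four_polytope_maximal`
holds: an occurring triple of a tensor of format `≤ 4×4×4` has positive Kronecker coefficient and at
most `4` parts, and "some multiple occurs" is closed under row-wise sums, so a strong induction on
the degree concludes. (BI 2011, Lemma 10.18–10.19: it suffices to treat generators; the generators
and their certificates are the computational content of the source and are NOT supplied here.)
[cite: vandenBergChristandlLysikovNieuwboerWalterZuiddam2025, §1 after Cor. 1.5]
[cite: BurgisserIkenmeyer2011, Lemma 10.18–10.19] -/
theorem vandenBergEtAl2025_unitTensor_four_polytope_maximal_of_split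
    (H : ∀ (n : ℕ) (lam : Fin 3 → Nat.Partition n), 0 < n →
      0 < kroneckerCoeff ℂ (lam 0) (lam 1) (lam 2) → (∀ j, (lam j).parts.card ≤ 4) →
      (∃ (k : ℕ) (mu : Fin 3 → Nat.Partition (k * n)), 0 < k ∧
          (∀ j, (mu j).parts = (lam j).parts.map (fun p => k * p)) ∧
          isotypicSum₁ (mu 0) (isotypicSum₂ (mu 1) (isotypicSum₃ (mu 2)
            (kroneckerPow (unitTensor ℂ 4) (k * n)))) ≠ 0) ∨
      (∃ (n₁ n₂ : ℕ) (_ : n₁ + n₂ = n) (lam₁ : Fin 3 → Nat.Partition n₁)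
          (lam₂ : Fin 3 → Nat.Partition n₂), 0 < n₁ ∧ 0 < n₂ ∧
          0 < kroneckerCoeff ℂ (lam₁ 0) (lam₁ 1) (lam₁ 2) ∧ 0 < kroneckerCoeff ℂ (lam₂ 0) (lam₂ 1) (lam₂ 2) ∧
          (∀ j, (lam₁ j).parts.card ≤ 4) ∧ (∀ j, (lam₂ j).parts.card ≤ 4) ∧
          ∀ j, (lam j).parts = ((lam₁ j).rowAdd (lam₂ j)).parts)) :
    vandenBergEtAl2025_unitTensor_four_polytope_maximal := by
  intro ι κ μ _ _ _ hι hκ hμ s n lam hn hocc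
  have hg := kroneckerCoeff_pos_of_isotypicSum₁₂₃_kroneckerPow_ne_zero hocc
  obtain ⟨c₀, c₁, c₂⟩ := card_parts_le_of_isotypicSum₁₂₃_kroneckerPow_ne_zero hocc
  have hcard : ∀ j, (lam j).parts.card ≤ 4 := by
    intro j
    fin_cases j
    · exact c₀.trans hι
    · exact c₁.trans hκ
    · exact c₂.trans hμ
  clear hocc c₀ c₁ c₂
  -- strong induction on the degree, inside the Kronecker semigroup
  induction n using Nat.strong_induction_on with
  | _ n ih =>
    rcases H n lam hn hg hcard with hbasic | ⟨n₁, n₂, e, lam₁, lam₂, hn₁, hn₂, hg₁, hg₂, hc₁, hc₂, hparts⟩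
    · exact hbasic
    · subst e
      have h₁ := ih n₁ (by omega) lam₁ hn₁ hg₁ hc₁
      have h₂ := ih n₂ (by omega) lam₂ hn₂ hg₂ hc₂
      obtain ⟨k, rho, hk, hrho, hocc⟩ := exists_mul_rowAdd_isotypicSum₁₂₃_kroneckerPow_ne_zero h₁ h₂
      exact ⟨k, rho, hk, fun j => by rw [hrho j, hparts j], hocc⟩

end Literature.Computability.AlgebraicComplexity
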